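import Mathlib
import Summits.MatrixMultiplication.MatrixMultiplication.Theorems.LieRankDesigns.Negative.RadicalBoxes

/-!
# Transversal column-fixing hosts never pass a level-`k` identity test (negative lemma, crux `LieRankDesigns`, 7614)

Line `subgroup-hosts-one-function` of crux `LieRankDesigns` (stmt-MatrixMultiplication-7614) takes three conjugates
`H, H^{g₂}, H^{g₃}` of a column-fixing host `H ≤ Fix(W')` (`W' = ⟨e_j : j ≥ k⟩`, `H ⊇ N_{W'} = [[1,0],[C,1]]`) in
TRANSVERSAL position (`W' + g₂W' = 𝔽_p^n`, `(W' ∩ g₂W') + g₃W' = 𝔽_p^n`) and asks (registered stub S3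
`stub_transversalIdentityTest`) for ONE level-`k` function `f = Σ_{rk M ≤ k} c_M ψ(tr(M·))` with `f(1) = 1` and
`f = 0` on `H·H^{g₂}·H^{g₃} ∖ 1`.  `no_idTest_of_transversal_radicals` shows no such function exists, at any cell,
any prime and any `g₂` with `W' + g₂W' = 𝔽_p^n`, `W' ∩ g₂W' ≠ 0`, already for the radicals and `d = 1`; the stub's
negation is `Negative/TransversalIdentityTestFalse.lean`.

Mechanism.  Pick `l₀ ∈ W' ∩ g₂W' ∖ 0` (`l₀ = g₂w₁`), `w₀ ∈ W' ∖ g₂W'` with a separating vector `φ` (`φ·w₀ = 1`,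
`φ ⊥ g₂W'`), `k` columns `e_{σ i} ⊆ W'` avoiding the support index `j₀` of `l₀` (`2k < n`), and the matrix `Λ`
with top rows `Ā` (`Ā e_{σ i} = e_i`, `Ā l₀ = 0`) and `Λ l₀ = w₀`.  The tested set contains the box
`P(T, θ) = (1 + n₁(T)) · g₂(1 + w₁θ̃ᵀ)g₂⁻¹ = 1 + n₁(T) + l₀(θ̃ g₂⁻¹)ᵀ` (both factors radical, hence hosts).  Summing
`ψ(−tr(Λ(P−1))) f(P)` over `(T, θ) ∈ M_n(𝔽_p) × 𝔽_p^n`: the test side counts the `(T, θ)` with `P = 1` — a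
positive integer; the Fourier side is `Σ_M c_M ψ(tr M) · p^{n²}[top-right block of M = Ā] · p^n[(M−Λ)l₀ ∈ g₂W']`,
and for such `M` the frame `x = (e_0, …, e_{k−1}, φ − Σ rᵢeᵢ)`, `y = (e_{σ0}, …, e_{σ(k−1)}, l₀)` is biorthogonal
through `M`, so `rk M ≥ k + 1` and `c_M = 0`.  Contradiction.  (In words: the tested set contains the unipotent
radical `U` of a parabolic of type `(n−2k, k, k)` and `F_k|_U` misses the characters `χ_{α,β}` of `U` with
`rk α + rk β > k`.)  Sorry-free; standard axioms.
-/

set_option linter.dupNamespace false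

noncomputable section

open scoped BigOperators
open Matrix

namespace Summit.MatrixMultiplication.MatrixMultiplication.Theorems.LieRankDesigns.Negative

variable {p n : ℕ} [Fact p.Prime]

/-! ## The obstruction -/

/-- **No level-`k` identity test on transversal radicals.**  Let `1 ≤ k`, `g₂ ∈ GL_n(𝔽_p)` with `W' + g₂W' = 𝔽_p^n`
and `W' ∩ g₂W' ≠ 0` (`W' = ⟨e_j : j ≥ k⟩`).  Then there is NO coefficient table `c` of Fourier rank `≤ k` whose
function `f = Σ_M c_M ψ(tr(M·))` has `f(1) = 1` and `f(a · g₂bg₂⁻¹) = 0` for all radical elements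
`a, b ∈ N_{W'} = [[1,0],[C,1]]` with `a · g₂bg₂⁻¹ ≠ 1`.  (Proof: character sum over the box
`(1 + n₁(T)) · g₂(1 + w₁θ̃ᵀ)g₂⁻¹` against `ψ(−tr(Λ ·))`; see the module docstring.) -/
theorem no_idTest_of_transversal_radicals (k : ℕ) (hk : 1 ≤ k) (g₂ : GLm p n)
    (htop : Submodule.span (ZMod p) (Set.range fun j : {j : Fin n // k ≤ (j : ℕ)} => Pi.single (j : Fin n) (1 : ZMod p)) ⊔
        (Submodule.span (ZMod p)
          (Set.range fun j : {j : Fin n // k ≤ (j : ℕ)} => Pi.single (j : Fin n) (1 : ZMod p))).map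
          (Matrix.toLin' (g₂ : Mat p n)) = ⊤)
    (hne : Submodule.span (ZMod p) (Set.range fun j : {j : Fin n // k ≤ (j : ℕ)} => Pi.single (j : Fin n) (1 : ZMod p)) ⊓
        (Submodule.span (ZMod p)
          (Set.range fun j : {j : Fin n // k ≤ (j : ℕ)} => Pi.single (j : Fin n) (1 : ZMod p))).map
          (Matrix.toLin' (g₂ : Mat p n)) ≠ ⊥)
    (c : Mat p n → ℂ) (hc : RankSupp k c) (h1 : fourierFn c 1 = 1)
    (h0 : ∀ a b : GLm p n,
      (∀ i j : Fin n, ((i : ℕ) < k ∨ k ≤ (j : ℕ)) → (a : Mat p n) i j = (1 : Mat p n) i j) →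
      (∀ i j : Fin n, ((i : ℕ) < k ∨ k ≤ (j : ℕ)) → (b : Mat p n) i j = (1 : Mat p n) i j) →
      a * (g₂ * b * g₂⁻¹) ≠ 1 → fourierFn c (a * (g₂ * b * g₂⁻¹)) = 0) : False := by
  classical
  set W : Submodule (ZMod p) (Fin n → ZMod p) :=
    Submodule.span (ZMod p) (Set.range fun j : {j : Fin n // k ≤ (j : ℕ)} => Pi.single (j : Fin n) (1 : ZMod p))
    with hW
  set g : Mat p n := (g₂ : Mat p n) with hg
  set gi : Mat p n := ((g₂⁻¹ : GLm p n) : Mat p n) with hgi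
  have hggi : g * gi = 1 := by rw [hg, hgi, ← Units.val_mul, mul_inv_cancel, Units.val_one]
  have hgig : gi * g = 1 := by rw [hg, hgi, ← Units.val_mul, inv_mul_cancel, Units.val_one]
  have hmemW : ∀ v, v ∈ W ↔ ∀ i : Fin n, (i : ℕ) < k → v i = 0 := fun v => mem_coSpan_iff k v
  have h2k : 2 * k < n := two_mul_lt_of_transversal k g₂ htop hne
  -- `l₀ ∈ W' ∩ g₂W' ∖ 0`, `l₀ = g w₁`
  obtain ⟨l0, hl0mem, hl0ne⟩ := Submodule.exists_mem_ne_zero_of_ne_bot hne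
  obtain ⟨hl0W, hl0W2⟩ := Submodule.mem_inf.mp hl0mem
  obtain ⟨w1, hw1W, hw1⟩ := Submodule.mem_map.mp hl0W2
  rw [Matrix.toLin'_apply] at hw1
  have hl0z : ∀ i : Fin n, (i : ℕ) < k → l0 i = 0 := (hmemW l0).1 hl0W
  have hw1z : ∀ i : Fin n, (i : ℕ) < k → w1 i = 0 := (hmemW w1).1 hw1W
  obtain ⟨j0, hj0⟩ := Function.ne_iff.mp hl0ne
  have hj0' : l0 j0 ≠ 0 := by simpa using hj0
  have hkj0 : k ≤ (j0 : ℕ) := by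
    by_contra h
    exact hj0' (hl0z j0 (not_le.mp h))
  -- `w₀ ∈ W' ∖ g₂W'` and a separating vector `φ`
  have hnot : ¬ (W ≤ W.map (Matrix.toLin' g)) := by
    intro hle
    have htop' : W.map (Matrix.toLin' g) = ⊤ := by
      rw [← htop]; exact (sup_eq_right.mpr hle).symm
    have hfin : Module.finrank (ZMod p) (W.map (Matrix.toLin' g)) ≤ n - k :=
      (Submodule.finrank_map_le _ _).trans ((finrank_range_le_card _).trans (card_subtype_ge_le k))
    rw [htop', finrank_top, Module.finrank_fintype_fun_eq_card, Fintype.card_fin] at hfin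
    omega
  obtain ⟨w0, hw0W, hw0n⟩ := Set.not_subset.mp hnot
  obtain ⟨φ, hφ1, hφ0⟩ := exists_vec_sep _ w0 hw0n
  have hw0z : ∀ i : Fin n, (i : ℕ) < k → w0 i = 0 := (hmemW w0).1 hw0W
  -- the skipped column selection `σ` and the matrix `Λ`
  let σv : ℕ → ℕ := fun i => if i + k < (j0 : ℕ) then i + k else i + k + 1
  have hσlt : ∀ i, i < k → σv i < n := by
    intro i hi; simp only [σv]; split_ifs <;> omega
  have hσge : ∀ i, k ≤ σv i := by
    intro i; simp only [σv]; split_ifs <;> omega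
  have hσne : ∀ i, σv i ≠ (j0 : ℕ) := by
    intro i; simp only [σv]; split_ifs <;> omega
  have hσinj : ∀ i i', σv i = σv i' → i = i' := by
    intro i i' h; simp only [σv] at h; split_ifs at h <;> omega
  let L : Fin n → ZMod p := fun i => ∑ j : Fin n, if (j : ℕ) = σv i then l0 j else 0
  let Abar : Fin n → Fin n → ZMod p := fun i j =>
    (if (j : ℕ) = σv i then 1 else 0) - (if j = j0 then L i * (l0 j0)⁻¹ else 0)
  let Λ : Mat p n := Matrix.of fun i j =>
    if (i : ℕ) < k then Abar i j else w0 i * (l0 j0)⁻¹ * (if j = j0 then 1 else 0)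
  have hΛtop : ∀ i j : Fin n, (i : ℕ) < k → Λ i j = Abar i j := by
    intro i j hi; simp only [Λ, Matrix.of_apply, if_pos hi]
  have hΛbot : ∀ i j : Fin n, ¬ (i : ℕ) < k → Λ i j = w0 i * (l0 j0)⁻¹ * (if j = j0 then 1 else 0) := by
    intro i j hi; simp only [Λ, Matrix.of_apply, if_neg hi]
  have hΛl0 : Λ *ᵥ l0 = w0 := by
    ext i
    simp only [mulVec, dotProduct]
    by_cases hi : (i : ℕ) < k
    · simp only [hΛtop i _ hi, Abar, sub_mul, Finset.sum_sub_distrib]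
      have hA : ∑ j : Fin n, (if (j : ℕ) = σv i then (1 : ZMod p) else 0) * l0 j = L i := by
        simp only [L]
        refine Finset.sum_congr rfl fun j _ => ?_
        split_ifs <;> simp
      have hB : ∑ j : Fin n, (if j = j0 then L i * (l0 j0)⁻¹ else 0) * l0 j = L i := by
        rw [Finset.sum_eq_single j0 (fun j _ hj => by rw [if_neg hj, zero_mul])
          (fun h => absurd (Finset.mem_univ j0) h)]
        rw [if_pos rfl, mul_assoc, inv_mul_cancel₀ hj0', mul_one]
      rw [hA, hB, sub_self, hw0z i hi]
    · simp only [hΛbot i _ hi]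
      rw [Finset.sum_eq_single j0 (fun j _ hj => by rw [if_neg hj, mul_zero, zero_mul])
        (fun h => absurd (Finset.mem_univ j0) h)]
      rw [if_pos rfl, mul_one, mul_assoc, inv_mul_cancel₀ hj0', mul_one]
  -- the box: radical blocks `n₁(T)`, truncated rows `θ̃`, `m₂(θ) = w₁ θ̃ᵀ`, `n₂(θ) = g m₂ g⁻¹ = l₀ (θ̃ g⁻¹)`
  let n1 : (Fin n → Fin n → ZMod p) → Mat p n := fun T =>
    Matrix.of fun i j => if k ≤ (i : ℕ) ∧ (j : ℕ) < k then T i j else 0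
  let θp : (Fin n → ZMod p) → (Fin n → ZMod p) := fun θ t => if (t : ℕ) < k then θ t else 0
  let m2 : (Fin n → ZMod p) → Mat p n := fun θ => vecMulVec w1 (θp θ)
  let n2 : (Fin n → ZMod p) → Mat p n := fun θ => vecMulVec l0 (θp θ ᵥ* gi)
  have hn1sq : ∀ T, n1 T * n1 T = 0 := by
    intro T; ext i j
    simp only [Matrix.mul_apply, Matrix.zero_apply]
    refine Finset.sum_eq_zero fun t _ => ?_
    simp only [n1, Matrix.of_apply]
    split_ifs <;> first | (exfalso; omega) | simp
  have hθw : ∀ θ, θp θ ⬝ᵥ w1 = 0 := by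
    intro θ; simp only [dotProduct, θp]
    refine Finset.sum_eq_zero fun t _ => ?_
    by_cases ht : (t : ℕ) < k
    · rw [hw1z t ht, mul_zero]
    · rw [if_neg ht, zero_mul]
  have hm2sq : ∀ θ, m2 θ * m2 θ = 0 := by
    intro θ; simp only [m2]; rw [vecMulVec_mul_vecMulVec, hθw, zero_smul, vecMulVec_zero]
  let aU : (Fin n → Fin n → ZMod p) → GLm p n := fun T =>
    ⟨1 + n1 T, 1 - n1 T,
      by rw [add_mul, mul_sub, mul_sub, one_mul, one_mul, mul_one, hn1sq]; abel,
      by rw [sub_mul, mul_add, mul_add, one_mul, one_mul, mul_one, hn1sq]; abel⟩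
  let bU : (Fin n → ZMod p) → GLm p n := fun θ =>
    ⟨1 + m2 θ, 1 - m2 θ,
      by rw [add_mul, mul_sub, mul_sub, one_mul, one_mul, mul_one, hm2sq]; abel,
      by rw [sub_mul, mul_add, mul_add, one_mul, one_mul, mul_one, hm2sq]; abel⟩
  have haU : ∀ T, (aU T : Mat p n) = 1 + n1 T := fun T => rfl
  have hbU : ∀ θ, (bU θ : Mat p n) = 1 + m2 θ := fun θ => rfl
  have haRad : ∀ T (i j : Fin n), ((i : ℕ) < k ∨ k ≤ (j : ℕ)) → (aU T : Mat p n) i j = (1 : Mat p n) i j := by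
    intro T i j hij
    rw [haU, Matrix.add_apply]
    simp only [n1, Matrix.of_apply]
    rw [if_neg (by omega), add_zero]
  have hbRad : ∀ θ (i j : Fin n), ((i : ℕ) < k ∨ k ≤ (j : ℕ)) → (bU θ : Mat p n) i j = (1 : Mat p n) i j := by
    intro θ i j hij
    rw [hbU, Matrix.add_apply]
    simp only [m2, vecMulVec_apply, θp]
    rcases hij with hi | hj
    · rw [hw1z i hi, zero_mul, add_zero]
    · rw [if_neg (by omega), mul_zero, add_zero]
  have hconj : ∀ θ, g * (1 + m2 θ) * gi = 1 + n2 θ := by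
    intro θ
    rw [mul_add, mul_one, add_mul, hggi]
    simp only [m2, n2]
    rw [mul_vecMulVec, hw1, vecMulVec_mul]
  have hn1l0 : ∀ T, n1 T *ᵥ l0 = 0 := by
    intro T; ext i
    simp only [mulVec, dotProduct, n1, Matrix.of_apply, Pi.zero_apply]
    refine Finset.sum_eq_zero fun j _ => ?_
    by_cases hj : (j : ℕ) < k
    · rw [hl0z j hj, mul_zero]
    · rw [if_neg (by omega), zero_mul]
  have hn1n2 : ∀ T θ, n1 T * n2 θ = 0 := by
    intro T θ; simp only [n2]; rw [mul_vecMulVec, hn1l0, zero_vecMulVec]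
  have hPval : ∀ T θ, ((aU T * (g₂ * bU θ * g₂⁻¹) : GLm p n) : Mat p n) = 1 + (n1 T + n2 θ) := by
    intro T θ
    rw [Units.val_mul, Units.val_mul, Units.val_mul, haU, hbU, ← hg, ← hgi, hconj θ,
      add_mul, one_mul, mul_add, mul_one, hn1n2, add_zero]
    abel
  -- the character sum, evaluated on the test side …
  set total : ℂ := ∑ T : Fin n → Fin n → ZMod p, ∑ θ : Fin n → ZMod p,
    ZMod.stdAddChar (-Matrix.trace (Λ * (n1 T + n2 θ))) * fourierFn c (aU T * (g₂ * bU θ * g₂⁻¹)) with htotal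
  have hterm : ∀ T θ, ZMod.stdAddChar (-Matrix.trace (Λ * (n1 T + n2 θ))) *
      fourierFn c (aU T * (g₂ * bU θ * g₂⁻¹)) = if n1 T + n2 θ = 0 then 1 else 0 := by
    intro T θ
    by_cases hz : n1 T + n2 θ = 0
    · have hP1 : aU T * (g₂ * bU θ * g₂⁻¹) = 1 := by
        apply Units.ext
        rw [hPval, hz, add_zero, Units.val_one]
      rw [if_pos hz, hz, mul_zero, Matrix.trace_zero, neg_zero, AddChar.map_zero_eq_one, hP1, h1, one_mul]
    · have hP1 : aU T * (g₂ * bU θ * g₂⁻¹) ≠ 1 := by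
        intro h
        apply hz
        have hv := congrArg (fun u : GLm p n => (u : Mat p n)) h
        simp only [hPval, Units.val_one] at hv
        simpa using hv
      rw [if_neg hz, h0 _ _ (haRad T) (hbRad θ) hP1, mul_zero]
  have hW1 : total ≠ 0 := by
    have hcount : ∀ T : Fin n → Fin n → ZMod p,
        ∑ θ : Fin n → ZMod p, (if n1 T + n2 θ = 0 then (1 : ℂ) else 0) =
          ((Finset.univ.filter fun θ : Fin n → ZMod p => n1 T + n2 θ = 0).card : ℂ) := fun T =>
      (Finset.natCast_card_filter _ _).symm
    have htot : total = ((∑ T : Fin n → Fin n → ZMod p,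
        (Finset.univ.filter fun θ : Fin n → ZMod p => n1 T + n2 θ = 0).card : ℕ) : ℂ) := by
      rw [htotal, Nat.cast_sum]
      refine Finset.sum_congr rfl fun T _ => ?_
      rw [← hcount T]
      exact Finset.sum_congr rfl fun θ _ => hterm T θ
    have hn10 : n1 0 = 0 := by
      ext i j; simp [n1]
    have hn20 : n2 0 = 0 := by
      have hθ0 : θp 0 = 0 := by ext t; simp [θp]
      simp only [n2, hθ0, zero_vecMul, vecMulVec_zero]
    have hpos : 1 ≤ ∑ T : Fin n → Fin n → ZMod p,
        (Finset.univ.filter fun θ : Fin n → ZMod p => n1 T + n2 θ = 0).card := by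
      have h00 : 1 ≤ (Finset.univ.filter fun θ : Fin n → ZMod p => n1 0 + n2 θ = 0).card :=
        Finset.card_pos.mpr ⟨0, Finset.mem_filter.mpr ⟨Finset.mem_univ _, by rw [hn10, hn20, add_zero]⟩⟩
      exact h00.trans (Finset.single_le_sum (f := fun T : Fin n → Fin n → ZMod p =>
        (Finset.univ.filter fun θ : Fin n → ZMod p => n1 T + n2 θ = 0).card)
        (fun T _ => Nat.zero_le _) (Finset.mem_univ (0 : Fin n → Fin n → ZMod p)))
    rw [htot, Nat.cast_ne_zero]
    omega
  -- … and on the Fourier side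
  let aM : Mat p n → Fin n → Fin n → ZMod p := fun M i j =>
    if k ≤ (i : ℕ) ∧ (j : ℕ) < k then (M - Λ) j i else 0
  let uM : Mat p n → Fin n → ZMod p := fun M t =>
    if (t : ℕ) < k then (gi *ᵥ ((M - Λ) *ᵥ l0)) t else 0
  have htr1 : ∀ M T, Matrix.trace ((M - Λ) * n1 T) = ∑ i : Fin n, ∑ j : Fin n, aM M i j * T i j := by
    intro M T
    simp only [Matrix.trace, Matrix.diag, Matrix.mul_apply]
    rw [Finset.sum_comm]
    refine Finset.sum_congr rfl fun i _ => Finset.sum_congr rfl fun j _ => ?_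
    simp only [n1, aM, Matrix.of_apply]
    split_ifs <;> simp
  have htr2 : ∀ M θ, Matrix.trace ((M - Λ) * n2 θ) = ∑ t : Fin n, uM M t * θ t := by
    intro M θ
    simp only [n2]
    rw [mul_vecMulVec, trace_vecMulVec, dotProduct_comm, ← dotProduct_mulVec]
    simp only [dotProduct, θp, uM]
    refine Finset.sum_congr rfl fun t _ => ?_
    split_ifs <;> ring
  have hW2 : total = ∑ M : Mat p n, c M * (ZMod.stdAddChar (Matrix.trace M) *
      ((∑ T : Fin n → Fin n → ZMod p, ZMod.stdAddChar (∑ i : Fin n, ∑ j : Fin n, aM M i j * T i j)) *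
       (∑ θ : Fin n → ZMod p, ZMod.stdAddChar (∑ t : Fin n, uM M t * θ t)))) := by
    have hstep : ∀ T θ, ZMod.stdAddChar (-Matrix.trace (Λ * (n1 T + n2 θ))) *
        fourierFn c (aU T * (g₂ * bU θ * g₂⁻¹)) =
        ∑ M : Mat p n, c M * (ZMod.stdAddChar (Matrix.trace M) *
          (ZMod.stdAddChar (∑ i : Fin n, ∑ j : Fin n, aM M i j * T i j) *
            ZMod.stdAddChar (∑ t : Fin n, uM M t * θ t))) := by
      intro T θ
      unfold fourierFn
      rw [hPval, Finset.mul_sum]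
      refine Finset.sum_congr rfl fun M _ => ?_
      rw [← htr1 M T, ← htr2 M θ, ← AddChar.map_add_eq_mul, ← AddChar.map_add_eq_mul, mul_left_comm,
        ← AddChar.map_add_eq_mul]
      congr 2
      simp only [Matrix.mul_add, Matrix.mul_one, Matrix.sub_mul, Matrix.trace_add, Matrix.trace_sub]
      ring
    calc total = ∑ T : Fin n → Fin n → ZMod p, ∑ θ : Fin n → ZMod p, ∑ M : Mat p n,
          c M * (ZMod.stdAddChar (Matrix.trace M) *
            (ZMod.stdAddChar (∑ i : Fin n, ∑ j : Fin n, aM M i j * T i j) *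
              ZMod.stdAddChar (∑ t : Fin n, uM M t * θ t))) := by
          rw [htotal]
          exact Finset.sum_congr rfl fun T _ => Finset.sum_congr rfl fun θ _ => hstep T θ
      _ = ∑ T : Fin n → Fin n → ZMod p, ∑ M : Mat p n, ∑ θ : Fin n → ZMod p,
          c M * (ZMod.stdAddChar (Matrix.trace M) *
            (ZMod.stdAddChar (∑ i : Fin n, ∑ j : Fin n, aM M i j * T i j) *
              ZMod.stdAddChar (∑ t : Fin n, uM M t * θ t))) :=
          Finset.sum_congr rfl fun T _ => Finset.sum_comm
      _ = ∑ M : Mat p n, ∑ T : Fin n → Fin n → ZMod p, ∑ θ : Fin n → ZMod p,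
          c M * (ZMod.stdAddChar (Matrix.trace M) *
            (ZMod.stdAddChar (∑ i : Fin n, ∑ j : Fin n, aM M i j * T i j) *
              ZMod.stdAddChar (∑ t : Fin n, uM M t * θ t))) := Finset.sum_comm
      _ = _ := by
          refine Finset.sum_congr rfl fun M _ => ?_
          rw [Finset.sum_mul_sum, Finset.mul_sum, Finset.mul_sum]
          refine Finset.sum_congr rfl fun T _ => ?_
          rw [Finset.mul_sum, Finset.mul_sum]
  -- `good M ⇒ rk M > k`
  have hrank : ∀ M : Mat p n, aM M = 0 → uM M = 0 → k < M.rank := by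
    intro M ha hu
    have hgood1 : ∀ i j : Fin n, k ≤ (i : ℕ) → (j : ℕ) < k → M j i = Λ j i := by
      intro i j hi hj
      have hij := congrFun (congrFun ha i) j
      simp only [aM, if_pos (And.intro hi hj), Pi.zero_apply, Matrix.sub_apply] at hij
      exact sub_eq_zero.mp hij
    have hgood2 : φ ⬝ᵥ (M *ᵥ l0) = 1 := by
      have hmemq : gi *ᵥ ((M - Λ) *ᵥ l0) ∈ W := by
        rw [hmemW]
        intro t ht
        have hut := congrFun hu t
        simpa [uM, ht] using hut
      have hDl0 : (M - Λ) *ᵥ l0 ∈ W.map (Matrix.toLin' g) := by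
        refine Submodule.mem_map.mpr ⟨_, hmemq, ?_⟩
        rw [Matrix.toLin'_apply, Matrix.mulVec_mulVec, hggi, Matrix.one_mulVec]
      have hφ := hφ0 _ hDl0
      rw [Matrix.sub_mulVec, hΛl0, dotProduct_sub, hφ1] at hφ
      exact sub_eq_zero.mp hφ
    -- coordinates of the biorthogonal frame
    let eF : Fin k → Fin n := fun a => ⟨a, by omega⟩
    let σF : Fin k → Fin n := fun b => ⟨σv b, hσlt b b.isLt⟩
    have heF : ∀ a : Fin k, ((eF a : Fin n) : ℕ) < k := fun a => a.isLt
    have hF1 : ∀ a b : Fin k, M (eF a) (σF b) = if a = b then 1 else 0 := by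
      intro a b
      rw [hgood1 (σF b) (eF a) (hσge b) (heF a), hΛtop _ _ (heF a)]
      have hne : (σF b : Fin n) ≠ j0 := fun h => hσne b (congrArg Fin.val h)
      simp only [Abar, if_neg hne, sub_zero]
      by_cases hab : a = b
      · subst hab
        rw [if_pos rfl, if_pos rfl]
      · rw [if_neg hab, if_neg]
        intro h
        exact hab (Fin.ext (hσinj _ _ h).symm)
    have hF2 : ∀ a : Fin k, (M *ᵥ l0) (eF a) = 0 := by
      intro a
      have hMΛ : (M *ᵥ l0) (eF a) = (Λ *ᵥ l0) (eF a) := by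
        simp only [mulVec, dotProduct]
        refine Finset.sum_congr rfl fun j _ => ?_
        by_cases hj : (j : ℕ) < k
        · rw [hl0z j hj, mul_zero, mul_zero]
        · rw [hgood1 j (eF a) (not_lt.mp hj) (heF a)]
      rw [hMΛ, hΛl0]
      exact hw0z _ (heF a)
    let r : Fin k → ZMod p := fun b => φ ⬝ᵥ (M *ᵥ Pi.single (σF b) 1)
    let xl : Fin n → ZMod p := φ - ∑ b : Fin k, r b • Pi.single (eF b) 1
    have hxl : ∀ v : Fin n → ZMod p, xl ⬝ᵥ v = φ ⬝ᵥ v - ∑ b : Fin k, r b * v (eF b) := by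
      intro v
      simp only [xl, sub_dotProduct, sum_dotProduct, smul_dotProduct, single_dotProduct, one_mul, smul_eq_mul]
    let x : Fin (k + 1) → (Fin n → ZMod p) := Fin.snoc (fun a : Fin k => Pi.single (eF a) 1) xl
    let y : Fin (k + 1) → (Fin n → ZMod p) := Fin.snoc (fun b : Fin k => Pi.single (σF b) 1) l0
    refine lt_rank_of_biorthogonal k M x y fun a b => ?_
    rcases Fin.eq_castSucc_or_eq_last a with ⟨a', rfl⟩ | rfl <;>
      rcases Fin.eq_castSucc_or_eq_last b with ⟨b', rfl⟩ | rfl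
    · simp only [x, y, Fin.snoc_castSucc, single_dotProduct, one_mul, mulVec_single_one, Matrix.col_apply, hF1,
        Fin.castSucc_inj]
    · simp only [x, y, Fin.snoc_castSucc, Fin.snoc_last, single_dotProduct, one_mul, hF2]
      rw [if_neg (Fin.castSucc_lt_last a').ne]
    · simp only [x, y, Fin.snoc_castSucc, Fin.snoc_last, hxl, mulVec_single_one, Matrix.col_apply, hF1, mul_ite,
        mul_one, mul_zero, Finset.sum_ite_eq', Finset.mem_univ, if_true]
      rw [if_neg (Fin.castSucc_lt_last b').ne']
      simp only [r, mulVec_single_one]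
      exact sub_self _
    · simp only [x, y, Fin.snoc_last, hxl, hF2, mul_zero, Finset.sum_const_zero, sub_zero, hgood2]
      rw [if_pos trivial]
  have hMzero : ∀ M : Mat p n, c M * (ZMod.stdAddChar (Matrix.trace M) *
      ((∑ T : Fin n → Fin n → ZMod p, ZMod.stdAddChar (∑ i : Fin n, ∑ j : Fin n, aM M i j * T i j)) *
       (∑ θ : Fin n → ZMod p, ZMod.stdAddChar (∑ t : Fin n, uM M t * θ t)))) = 0 := by
    intro M
    rw [sum_psi_mat, sum_psi_vec]
    by_cases ha : aM M = 0
    · by_cases hu : uM M = 0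
      · rw [hc M (hrank M ha hu), zero_mul]
      · rw [if_neg hu, mul_zero, mul_zero, mul_zero]
    · rw [if_neg ha, zero_mul, mul_zero, mul_zero]
  exact hW1 (by rw [hW2]; exact Finset.sum_eq_zero fun M _ => hMzero M)

end Summit.MatrixMultiplication.MatrixMultiplication.Theorems.LieRankDesigns.Negative

end
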